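import Summits.HubbardSuperconductivity.HubbardSuperconductivity.Theorems.WeakCouplingBCSWcbcsSsbToTorusLROReduction
import HarnessLib

/-!
# Crux `WcbcsSsbToTorusLRO` (stmt-HubbardSuperconductivity-2009) — line `off-zero-mode-moment-closure` ⊕ (N-half of
# `neutral-curvature-face-purity`): the lead's checked SKELETON (v6, lead c2 = prover-line-…-2009-c2-0, 2026-08-17;
# v1–v4 by lead a1, v5 by lead c1)

Crux (route `WeakCouplingBCS`, rank 2; `Iff.rfl`-twin of `NodalWardXY.SsbToTorusLRO` and of
`ChiralWindow.CwSsbToEvenTorusLRO` = stmt-10439; pointwise-weaker sibling of `AposterioriCapRg.SsbToEvenTorusLro` = stmt-1315):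

  `∃ U₀ > 0, ∀ U ∈ Ioo 0 U₀, ∀ δ ∈ Ioo 0 (1/2), ∀ μ, DensityMatched U δ μ → HasDWaveOrder U μ → HasDWavePairFieldLROAt U δ`.

v6 = v5 re-registered by lead c2 (stubs UNCHANGED: T, N, C are the only `sorry`s; nothing false, nothing misstated).
EVERYTHING BUT THE PHYSICS IS IN THE TREE: `Theorems/WeakCouplingBCSWcbcsSsbToTorusLROReduction.lean` (p91563)
`wcbcsSsbToTorusLRO_of_stiffness_curvature_charging : T → N → C → WcbcsSsbToTorusLRO`, through `…InfraredHalf.lean` (p90412: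
(T) ∧ (C) ⇒ pointwise InfraredLeak; consumes `stub_momentClosure` p86989, `stub_pairCommutatorBudget` p87816,
`stub_windowLatticeSums` p89356, `stub_twoParticleCost` p89916, F1 `Theorems.stub_doubleCommBound`), `…FacePurityHalf.lean`
(p91051: (N) ∧ supporting potential ∧ DM ∧ order ⇒ derivative face purity), item 9491 DISCHARGED by the landed
`CwSsbToEvenTorusLRO.stub_canonicalSupportingPotential`, the landed dissection `Negative.floor_of_deriv_of_leak` +
`Negative.hasDWavePairFieldLROAt_of_floor`. Companions (all ACCEPTED): `…Pointwise.lean` p141333 (composition POINTWISE at every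
`(U, δ, μ)` and the δ-first crux from δ-first children), `…ChargingRate.lean` p141071 ((C) from a power-law rate), `…FloatingChargingFloor.lean`
p142353 (the C-body verbatim at a floating even filling within `2(1+log L)²` of `N_L`: (C) is open only because the filling is pinned),
`…NeutralCurvatureResponseForm.lean` p143457 ((N) ⟺ h-uniform Lipschitz response bound; the tree gives `κ¹`, (N) needs `κ²`).
Lead c2 audit (NOTES.md of the c2 seat; PICKED.md): (a) SOURCE/REPULSION SQUEEZE — from sourced GC order alone every GS of the
REPELLED sourced problem `T_h + κW_R` keeps block coherence `≥ (m_L(h/2) − κ‖W_R‖/(hL²))² L²` (order survives repulsion only for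
`κ ≪ h`), while passing the repelled chord to the source-free canonical sector costs the symmetry-breaking gain
`E₀(K_μ) − E₀(T_h) ≈ 2mhL²` (invisible only for `h ≪ κ`): the two windows are disjoint, so an INTRINSIC amplitude-stiffness input is
necessary — that is (N); (b) (C) is removable iff a common-bottom reference keeps `H − E_ref ≥ 0` on both neighbouring sectors, i.e. iff
`pairGap ≥ 0`: irreducible at the pinned filling; (T) carries the O(1) phase-stiffness input (every-GS Goldstone susceptibility ceiling),
false at `U = 0` exactly (open shells), no supplier in the cone. Dossiers: `PROMOTE-T-N-C.md` (a1), `PROMOTE-T-N-C-c1.md`, `SPLIT-TNC.md`,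
`STRATEGY-CENSUS.md` (s1).
-/

noncomputable section

set_option linter.dupNamespace false

namespace Summit.HubbardSuperconductivity.HubbardSuperconductivity.Theorems.WcbcsSsbToTorusLRO

open Literature.MathematicalPhysics.QuantumLattice Literature.Probability.LatticeModels
open Matrix Filter Set
open scoped ComplexOrder ComplexConjugate
open Summit.HubbardSuperconductivity.HubbardSuperconductivity.Theses.WeakCouplingBCS (WcbcsSsbToTorusLRO)

/-! ## The three open stubs (the ONLY `sorry`s) -/

/-- **Stub T — `stub_torusPairStiffness` (OPEN; the O(1) input; held by the lead).** Torus pair STIFFNESS in the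
variational (resolvent-free) form, each neighbouring sector measured from its own bottom: under the crux hypotheses at
`(U, δ, μ)` there are `C` and a window `η > 0` such that, eventually along even sides `L = 2k+2`, for every normalised
`(N_L, S^z=0)`-sector ground state `ψ` of `H = hubbardTorus 2 L 1 U` and every momentum label `m ≠ 0` with `|q_m|² < η²`:
for all `w` in the sector `(N_L − 2, 0)`, `2 Re⟨w, Δ_d(m)ψ⟩ − Re⟨w, (H − E(N_L−2)) w⟩ ≤ C L²/|q_m|²`, and the same in
the sector `(N_L + 2, 0)` with `Δ_d(m)ᴴψ` and `E(N_L+2)` (`E(M) = minEnergyOn H (szSector M 0)`). Optimising over `w`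
this says the static pair susceptibility `M_ψ(q) = ⟨Δ(q)ψ, (H−E₋)⁻¹ Δ(q)ψ⟩` is `≤ C L²/|q|²` (Goldstone form,
physically `C ≈ 2m²/ρ_s + C_reg`), and it CONTAINS the momentum-alignment clause (`w` in the `(N_L∓2)` ground space
forces `Δ(q)ψ ⊥` it). False in a PDW / zero-stiffness phase; no supplier short of a zero-mode-factored construction. -/
theorem stub_torusPairStiffness :
    ∃ U₀ : ℝ, 0 < U₀ ∧ ∀ U ∈ Set.Ioo (0:ℝ) U₀, ∀ δ ∈ Set.Ioo (0:ℝ) (1 / 2), ∀ μ : ℝ, Filter.Tendsto (fun L : ℕ => ((hubbardTorusWith 2 (L + 1) 1 U μ).groundStateFunctional totalNumber).re / ((L + 1 : ℕ) : ℝ) ^ 2) Filter.atTop (nhds (1 - δ)) → HasDWaveOrder U μ → ∃ C η : ℝ, 0 < η ∧ ∀ᶠ k : ℕ in Filter.atTop, ∀ ψ : Fock (Orb (FermionTorus 2 (2 * k + 1 + 1))), IsGroundStateInSector (hubbardTorus 2 (2 * k + 1 + 1) 1 U) (2 * ⌊(1 - δ) * ((2 * k + 1 + 1 : ℕ) : ℝ)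 ^ 2 / 2⌋₊) 0 ψ → star ψ ⬝ᵥ ψ = 1 → ∀ m : TorusSite 2 (2 * k + 1 + 1), m ≠ 0 → momentumNormSq (2 * k + 1 + 1) m < η ^ 2 → (∀ w : Fock (Orb (FermionTorus 2 (2 * k + 1 + 1))), w ∈ szSector (Λ := FermionTorus 2 (2 * k + 1 + 1)) (2 * ⌊(1 - δ) * ((2 * k + 1 + 1 : ℕ) : ℝ) ^ 2 / 2⌋₊ - 2) 0 → 2 * (star w ⬝ᵥ (pairFieldAt dWaveFormFactor (2 * k + 1 + 1) m *ᵥ ψ)).re - ((star w ⬝ᵥ (hubbardTorus 2 (2 * k + 1 + 1) 1 U *ᵥ w)).re - (hubbardTorus 2 (2 * k + 1 + 1) 1 U).minEnergyOn (szSector (2 * ⌊(1 - δ) * ((2 * k + 1 + 1 : ℕ) : ℝ) ^ 2 / 2⌋₊ - 2) 0) * (star w ⬝ᵥ w).re) ≤ C * ((2 * k + 1 + 1 : ℕ) : ℝ) ^ 2 / momentumNormSq (2 * k + 1 + 1) m) ∧ (∀ w : Fock (Orb (FermionTorus 2 (2 * k + 1 + 1))), w ∈ szSector (Λ := FermionTorus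 2 (2 * k + 1 + 1)) (2 * ⌊(1 - δ) * ((2 * k + 1 + 1 : ℕ) : ℝ) ^ 2 / 2⌋₊ + 2) 0 → 2 * (star w ⬝ᵥ ((pairFieldAt dWaveFormFactor (2 * k + 1 + 1) m)ᴴ *ᵥ ψ)).re - ((star w ⬝ᵥ (hubbardTorus 2 (2 * k + 1 + 1) 1 U *ᵥ w)).re - (hubbardTorus 2 (2 * k + 1 + 1) 1 U).minEnergyOn (szSector (2 * ⌊(1 - δ) * ((2 * k + 1 + 1 : ℕ) : ℝ) ^ 2 / 2⌋₊ + 2) 0) * (star w ⬝ᵥ w).re) ≤ C * ((2 * k + 1 + 1 : ℕ) : ℝ) ^ 2 / momentumNormSq (2 * k + 1 + 1) m) := by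
  sorry

/-- **Stub N — `stub_neutralCurvature` (OPEN; co-held by the lead).** The h-UNIFORM floor on the NEUTRAL
(Kac-block direction) second difference of the sourced grand-canonical torus ground energy: under the crux hypotheses at
`(U, δ, μ)`, for every block scale `R` there are `C_R ≥ 0`, `κ₀ > 0`, `h₀ > 0` such that for all `κ ∈ (0, κ₀)` and all
source strengths `h ∈ (0, h₀)`, eventually in the side `L+1`,
`f(h,κ) + f(h,−κ) − 2 f(h,0) ≥ −C_R κ² (L+1)²`, `f(h,κ) = E₀(T_h + κ W_R)`, `T_h = dWaveSourceTorus (L+1) U μ h`,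
`W_R = R⁻⁴ Σ_a B_aᴴ B_a`. A static neutral susceptibility bound at FIXED `h > 0` (the constructor's habitat), typed `∀ R ∃ C_R`
(TRIAGE-r2-1 (e): `C` uniform in `R` is false) and `∀ κ ∀ h ∀ᶠ L` (quantifier hygiene, TRIAGE-r2-2 (b)); order-free (a metal
satisfies it); FALSE at equal-density coexistence with a pair-poor phase (honest edge, where the crux may fail too). -/
theorem stub_neutralCurvature :
    ∃ U₀ : ℝ, 0 < U₀ ∧ ∀ U ∈ Set.Ioo (0:ℝ) U₀, ∀ δ ∈ Set.Ioo (0:ℝ) (1 / 2), ∀ μ : ℝ, Filter.Tendsto (fun L : ℕ => ((hubbardTorusWith 2 (L + 1) 1 U μ).groundStateFunctional totalNumber).re / ((L + 1 : ℕ) : ℝ) ^ 2) Filter.atTop (nhds (1 - δ)) → HasDWaveOrder U μ → ∀ R : ℕ, 0 < R → ∃ C : ℝ, 0 ≤ C ∧ ∃ κ₀ : ℝ, 0 < κ₀ ∧ ∃ h₀ : ℝ, 0 < h₀ ∧ ∀ κ ∈ Set.Ioo (0:ℝ) κ₀, ∀ h ∈ Set.Ioo (0:ℝ) h₀, ∀ᶠ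 L : ℕ in Filter.atTop, -C * κ ^ 2 * ((L + 1 : ℕ) : ℝ) ^ 2 ≤ (dWaveSourceTorus (L + 1) U μ h + (κ : ℂ) • (((((R : ℝ) ^ 4)⁻¹ : ℝ) : ℂ) • ∑ a : Literature.Probability.LatticeModels.TorusSite 2 (L + 1), (∑ u : Fin 2 → Fin R, localPair dWaveFormFactor (L + 1) (a + fun i => ((u i : ℕ) : ZMod (L + 1))))ᴴ * (∑ u : Fin 2 → Fin R, localPair dWaveFormFactor (L + 1) (a + fun i => ((u i : ℕ) : ZMod (L + 1)))))).groundEnergy + (dWaveSourceTorus (L + 1) U μ h + ((-κ : ℝ) : ℂ) • (((((R : ℝ) ^ 4)⁻¹ : ℝ) : ℂ) • ∑ a : Literature.Probability.LatticeModels.TorusSite 2 (L + 1), (∑ u : Fin 2 → Fin R, localPair dWaveFormFactor (L + 1) (a + fun i => ((u i : ℕ) : ZMod (L + 1))))ᴴ * (∑ u : Fin 2 → Fin R, localPair dWaveFormFactor (L + 1) (a + fun i => ((u i : ℕ) : ZMod (L + 1)))))).groundEnergy - 2 * (dWaveSourceTorus (L + 1) U μ h).groundEnergy := by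
  sorry

/-- **Stub C — `stub_chargingFloor` (three sector energies; ED-testable).** Under the crux hypotheses at `(U, δ, μ)`: along
even sides the pair excitation gap `pairGap H N_L = ½[E(N_L+2) + E(N_L−2) − 2E(N_L)]` of the source-free canonical problem
is not negative at the `1/log L` scale: for every `ε > 0`, eventually `−ε ≤ (1 + log L) · pairGap (hubbardTorus 2 L 1 U) N_L`.
(Expected: `pairGap ≥ −cU/L²` from open-shell exchange, `+O(1/(κL²))` otherwise; false only at canonical phase separation,
where the crux is vacuous or false.) It pays for the `Σ_{q≠0} |q|⁻² ≍ L² log L` lattice sum in the moment closure. -/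
theorem stub_chargingFloor :
    ∃ U₀ : ℝ, 0 < U₀ ∧ ∀ U ∈ Set.Ioo (0:ℝ) U₀, ∀ δ ∈ Set.Ioo (0:ℝ) (1 / 2), ∀ μ : ℝ, Filter.Tendsto (fun L : ℕ => ((hubbardTorusWith 2 (L + 1) 1 U μ).groundStateFunctional totalNumber).re / ((L + 1 : ℕ) : ℝ) ^ 2) Filter.atTop (nhds (1 - δ)) → HasDWaveOrder U μ → ∀ ε : ℝ, 0 < ε → ∀ᶠ k : ℕ in Filter.atTop, -ε ≤ (1 + Real.log ((2 * k + 1 + 1 : ℕ) : ℝ)) * pairGap (hubbardTorus 2 (2 * k + 1 + 1) 1 U) (2 * ⌊(1 - δ) * ((2 * k + 1 + 1 : ℕ) : ℝ) ^ 2 / 2⌋₊) := by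
  sorry

/-! ## The skeleton theorem -/

/-- **The skeleton theorem (v6 = v4).** The three open physical stubs close the crux BY NAME through the landed reduction
`wcbcsSsbToTorusLRO_of_stiffness_curvature_charging` (p91563); no further hypothesis. -/
theorem WcbcsSsbToTorusLRO_of : WcbcsSsbToTorusLRO :=
  wcbcsSsbToTorusLRO_of_stiffness_curvature_charging stub_torusPairStiffness stub_neutralCurvature stub_chargingFloor

end Summit.HubbardSuperconductivity.HubbardSuperconductivity.Theorems.WcbcsSsbToTorusLRO

end
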